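import Summits.Ventures.HodgeRepro.Night4OpenFrontier
import Summits.Ventures.HodgeRepro.Night4ReducedDimRoute
import Summits.Ventures.HodgeRepro.Night4InvariantCycles
import Summits.Ventures.HodgeRepro.Night4CodimOne
import Summits.Ventures.HodgeRepro.Night4RouteCConditional

/-!
# The four chains of ROUTE.md in ONE statement: `S0 ⇐ printed ∧ the cell's lemmas ∧ (any one of the four open inputs)`

Blind re-derivation cell `pub-hodge-repro`, seat `night-4` (ROUTE HARDENING for the Monday FINAL, gen 2).  Target tree path
`lean/Summits/Ventures/HodgeRepro/Night4Closers.lean`.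

ROUTE.md §1 («Logical shape: S0 ⟸ S1 ∧ S2 ∧ S3 ∧ S4 … and independently S0 ⟸ S4ᶜ») and §4 («Closers of S4») present
four ways the one open statement S4 could close; night-4 g0–g2 typed each chain over its own interface:

* the OPEN FRONTIER (`Night4OpenFrontier`): S4 on the rank-four faces of the Galois CM fields of degree `≥ 8`
  (`S4facesDeg d`, `d ≥ 8`), with the cell's Lemmas L / P, Lemma R and the §3.2 count, and Markman Cor 1.6.1;
* the INVARIANT-CYCLES condition (`Night4InvariantCycles`): Conjecture 11.3.1 for all Hodge-type families, through
  Gordon 11.3.3 = Abdulali Thm 6.1;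
* the VARIATIONAL condition (`Night4RouteDeformation` / `Night4CodimOne`): `VHC` for the genuine pencils of André 6.3.3;
* ROUTE C (`Night4RouteC` / `Night4RouteCConditional`): BMM's twisted stabilisation (O-R2.3) with BMM Cor 2 as printed,
  R7 from print, the dominant ball quotients, Lieberman and vanishing.

This file merges the four interfaces into `ClosersData` (one `RouteData` with all the extra fields; the merge is by field
names — nothing new is asserted), bundles the PRINTED inputs (`PrintedInputs`) and the cell's UNPRINTED lemmas
(`CellLemmas`) as `Prop`-structures, names the four OPEN inputs (`OpenFrontier`, `OpenInvariantCycles`, `OpenVHC`,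
`OpenRouteC`) and proves

* `S0_of_any_closer : PrintedInputs 𝓒 → CellLemmas 𝓒 → (OpenFrontier 𝓒 ∨ OpenInvariantCycles 𝓒 ∨ OpenVHC 𝓒 ∨
  OpenRouteC 𝓒) → S0 𝓒.toRouteData`

— the DEMO-PACKET's «main theorem with every hypothesis verbatim and machine-checked as a statement», in the form
«what is printed, what is the cell's, what is open», with the four disjuncts the exact open inputs of ROUTE.md v2.88
§1 / §4 / CHECKPOINT §1.  Each printed field of `PrintedInputs` is a `def … : Prop` whose own file carries the quote and
store page:line.  Gen 3 adds ROUTE.md §4 item 3 (C1) as its own named open input: `OpenLefschetz` = the Lefschetz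
standard conjecture `B(X)` for the total space of every genuine pencil, which gives `OpenVHC` through the PRINTED Milne
2020 Prop 1 = Abdulali 1994 (`M1_Prop1`, now a field of `PrintedInputs`): `OpenVHC_of_openLefschetz`,
`S0_of_openLefschetz`, and the five-way `S0_of_any_closer₅`; and it replaces the count clause `ReducedFourfold_deg6` of
`CellLemmas` by the dictionary `DimReduced` (gen 1's `Night4ReducedDimRoute`: the count is kernel).  NO open input is closed; HC_CM is NOT proved; nothing here
asserts anything about the original programme.
-/

namespace HodgeRepro.Route

/-- **The merged interface**: the fields of `InvariantCyclesData` (⊇ `KnownRegimeData` ⊇ `RouteData`),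
`DeformationData` and `RouteCCondData` (⊇ `R7Data` ⊇ `RouteCData`) on ONE `RouteData`; overlapping fields (`dim`) are
merged by name.  The fields assert nothing. -/
structure ClosersData extends InvariantCyclesData, DeformationData, RouteCCondData

variable (𝓒 : ClosersData)

/-- **The PRINTED inputs of the four chains, bundled** (each a named `def … : Prop` with its quote and page:line in the
file that declares it). -/
structure PrintedInputs : Prop where
  /-- pull-back functoriality of algebraic classes; `H^0` algebraic (André 1996 Thm 0.3 (ii); van Geemen 2.1) -/
  pull : AlgPull 𝓒.toRouteData
  /-- S1 (Deligne §5 (c) / Milne 2020 Thm 1 proof) -/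
  s1 : S1 𝓒.toRouteData
  /-- S2 (Pohlmann; Gordon 9.2) -/
  s2 : S2 𝓒.toRouteData
  /-- S3 (André 1992 / Milne 2020 Thm 1) -/
  s3 : S3 𝓒.toRouteData
  /-- Markman 2025 Cor 1.6.1 (abelian fourfolds) -/
  markman : Markman2025_Cor1_6_1 𝓒.toKnownRegimeData
  /-- Gordon 11.3.3 = Abdulali 1994 Thm 6.1 -/
  gordon : Gordon_11_3_3 𝓒.toInvariantCyclesData
  /-- André 1996 Lemme 6.3.3: the complete pencil -/
  family : S4'_family 𝓒.toDeformationData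
  /-- Milne 2020 Prop 1 = Abdulali 1994 p. 1122: `B(X)` for the total space deforms algebraic classes along the pencil -/
  m1Prop1 : M1_Prop1 𝓒.toDeformationData
  /-- Deligne §5 (c): the Weil line consists of Hodge classes -/
  weilIsHodge : WeilIsHodge 𝓒.toRouteData
  /-- van Geemen 2.3: `p = 0, 1` -/
  vanGeemen23 : vanGeemen_2_3 𝓒.toRouteData
  /-- BMM 2016 Cor 2 as printed (under the twisted stabilisation) -/
  bmm : BMM_Cor2_asPrinted 𝓒.toRouteCCondData
  /-- Meng 2019 proof of Lemma 4.1, line by line: `f^*` preserves Hodge classes -/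
  hodgePull : HodgePull 𝓒.toR7Data
  /-- … cup products of algebraic classes are algebraic -/
  algCup : AlgCup 𝓒.toR7Data
  /-- … push-forwards of algebraic classes are algebraic -/
  algPush : AlgPush 𝓒.toR7Data
  /-- … the multisection `V` with `deg (f|_V) = d ≠ 0` -/
  projectionSection : ProjectionSection 𝓒.toR7Data
  /-- Lieberman: the inverse Lefschetz operator is algebraic on abelian varieties -/
  lefschetzSymmetry : LefschetzSymmetry 𝓒.toRouteCData
  /-- `H^{2k}(X) = 0` for `k > dim X` -/
  vanishAboveDim : VanishAboveDim 𝓒.toRouteCData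

/-- **The cell's UNPRINTED lemmas and dictionary clauses, bundled.** -/
structure CellLemmas : Prop where
  /-- Lemmas L / P: S4-faces ⟹ S4 -/
  lp : LemmasLP 𝓒.toRouteData
  /-- Lemma R (S3ᴿ) on the faces -/
  lemmaR : LemmaR_faces 𝓒.toKnownRegimeData
  /-- the dimension dictionary `dim B_red = TypeDatum.redDim` (`Night4ReducedDimRoute`); the §3.2 count itself —
  `redDim = 4` on every face of every degree-6 type datum — is KERNEL (`Night4ReducedDimTransport`), so
  `ReducedFourfold_deg6` follows (`ReducedFourfold_deg6_of_DimReduced`) -/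
  dimReduced : DimReduced 𝓒.toKnownRegimeData
  /-- CM abelian varieties are abelian varieties -/
  cmIsAbelian : CMIsAbelian 𝓒.toInvariantCyclesData

/-- **OPEN input 1 — the frontier**: S4 on the faces of the Galois CM fields of degree `≥ 8` (ROUTE.md §3.3 / §3.4). -/
def OpenFrontier : Prop :=
  ∀ d : ℕ, 8 ≤ d → S4facesDeg 𝓒.toRouteData d

/-- **OPEN input 2 — the invariant cycles conjecture for all families of abelian varieties of Hodge type**
(Gordon 11.3.1, the hypothesis of 11.3.3). -/
def OpenInvariantCycles : Prop :=
  InvariantCycles_HodgeType 𝓒.toInvariantCyclesData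

/-- **OPEN input 3 — VHC** for the genuine pencils (ROUTE.md §1 row S4′). -/
def OpenVHC : Prop :=
  VHC 𝓒.toDeformationData

/-- **OPEN input 3′ — the Lefschetz standard conjecture `B(X)` for the total space of every genuine pencil**
(ROUTE.md §4 item 3 = C1; André 1996 Remarque 2: HC for abelian varieties is equivalent to this question for compact
pencils). Through the printed `M1_Prop1` it gives `OpenVHC`. -/
def OpenLefschetz : Prop :=
  ∀ (p : ℕ) (B : 𝓒.Var) (P : Pencil 𝓒.toRouteData p B), 𝓒.IsPencil P → 𝓒.LefschetzStd P.total

/-- **OPEN input 4 — Route C's conditional content**: BMM's twisted stabilisation (O-R2.3) together with the dominant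
ball quotients of §4 item 1 (whose `p ≥ 3` part is itself conditional through R2.3 — see `ExistsDominantBallQuotient`). -/
def OpenRouteC : Prop :=
  𝓒.TwistedStabilization ∧ ExistsDominantBallQuotient 𝓒.toRouteCData

/-- **Chain 1** — the open frontier closes `S0` (`Night4OpenFrontier`). -/
theorem S0_of_openFrontier (hP : PrintedInputs 𝓒) (hL : CellLemmas 𝓒) (h : OpenFrontier 𝓒) : S0 𝓒.toRouteData :=
  S0_of_open_frontier 𝓒.toKnownRegimeData hP.pull ⟨hP.s1, hP.s2, hP.s3⟩ hL.lp hL.lemmaR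
    (ReducedFourfold_deg6_of_DimReduced 𝓒.toKnownRegimeData hL.dimReduced) hP.markman h

/-- **Chain 2** — the invariant cycles conjecture closes `S0` (`Night4InvariantCycles`). -/
theorem S0_of_openInvariantCycles (hP : PrintedInputs 𝓒) (hL : CellLemmas 𝓒) (h : OpenInvariantCycles 𝓒) :
    S0 𝓒.toRouteData :=
  S0_of_Gordon_11_3_3 𝓒.toInvariantCyclesData hP.gordon h hL.cmIsAbelian

/-- **Chain 3** — VHC closes `S0` (`Night4RouteDeformation` / `Night4CodimOne`). -/
theorem S0_of_openVHC (hP : PrintedInputs 𝓒) (h : OpenVHC 𝓒) : S0 𝓒.toRouteData :=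
  S0_of_chain_VHC_printed 𝓒.toDeformationData hP.pull ⟨hP.s1, hP.s2, hP.s3⟩ hP.family hP.weilIsHodge
    hP.vanGeemen23 h

/-- **Chain 3′** — `B(X)` for all total spaces gives `VHC` through the printed Milne Prop 1 (`Night4RouteDeformation`). -/
theorem OpenVHC_of_openLefschetz (hP : PrintedInputs 𝓒) (h : OpenLefschetz 𝓒) : OpenVHC 𝓒 :=
  fun p B P hP' => hP.m1Prop1 p B P hP' (h p B P hP')

/-- **Chain 3′** — the Lefschetz standard conjecture for the total spaces closes `S0` (ROUTE.md §4 item 3 = C1). -/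
theorem S0_of_openLefschetz (hP : PrintedInputs 𝓒) (h : OpenLefschetz 𝓒) : S0 𝓒.toRouteData :=
  S0_of_openVHC 𝓒 hP (OpenVHC_of_openLefschetz 𝓒 hP h)

/-- **Chain 4** — Route C closes `S0` (`Night4RouteC` / `Night4RouteCConditional`). -/
theorem S0_of_openRouteC (hP : PrintedInputs 𝓒) (h : OpenRouteC 𝓒) : S0 𝓒.toRouteData :=
  S0_of_routeC_conditional_printed 𝓒.toRouteCCondData h.1 hP.bmm hP.hodgePull hP.algCup hP.algPush
    hP.projectionSection h.2 hP.lefschetzSymmetry hP.vanishAboveDim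

/-- **THE FOUR CHAINS IN ONE STATEMENT**: `S0` follows from the printed inputs, the cell's lemmas, and ANY ONE of the
four open inputs of ROUTE.md v2.88 — the faces of degree `≥ 8`, the invariant cycles conjecture, VHC, or Route C's
conditional content. -/
theorem S0_of_any_closer (hP : PrintedInputs 𝓒) (hL : CellLemmas 𝓒)
    (h : OpenFrontier 𝓒 ∨ OpenInvariantCycles 𝓒 ∨ OpenVHC 𝓒 ∨ OpenRouteC 𝓒) : S0 𝓒.toRouteData := by
  rcases h with h | h | h | h
  · exact S0_of_openFrontier 𝓒 hP hL h
  · exact S0_of_openInvariantCycles 𝓒 hP hL h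
  · exact S0_of_openVHC 𝓒 hP h
  · exact S0_of_openRouteC 𝓒 hP h

/-- **FIVE NAMED OPEN INPUTS IN ONE STATEMENT** — the four above and C1 (`OpenLefschetz`, ROUTE.md §4 item 3) named
separately, as §4 ranks it (it implies `OpenVHC` through the printed `M1_Prop1`). -/
theorem S0_of_any_closer₅ (hP : PrintedInputs 𝓒) (hL : CellLemmas 𝓒)
    (h : OpenFrontier 𝓒 ∨ OpenInvariantCycles 𝓒 ∨ OpenVHC 𝓒 ∨ OpenLefschetz 𝓒 ∨ OpenRouteC 𝓒) :
    S0 𝓒.toRouteData := by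
  rcases h with h | h | h | h | h
  · exact S0_of_openFrontier 𝓒 hP hL h
  · exact S0_of_openInvariantCycles 𝓒 hP hL h
  · exact S0_of_openVHC 𝓒 hP h
  · exact S0_of_openLefschetz 𝓒 hP h
  · exact S0_of_openRouteC 𝓒 hP h

end HodgeRepro.Route
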